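import Literature.AlgebraicGeometry.HodgeTheory.IsoTransport
import Literature.AlgebraicGeometry.HodgeTheory.ClassesSupportedOn
import HarnessLib

/-!
# Crux `BlochSpreadEightFour` (stmt-HodgeConjecture-18884), line `bloch-lifts-fulton` — registered stub
# `stub_supportAlongChart`: classes supported on `i(Z) ⊂ X₀` read along a chart `e : X₀ ≅ X₁`

Routes `EightfoldBlochSeeds` / `EightfoldTwistedSheafSeeds` of `HodgeConjecture` (shared crux item
stmt-HodgeConjecture-18884, skeleton `Cruxes/BlochSpreadEightFour/Lines/bloch_lifts_fulton.lean`).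

Content (bookkeeping, no new mathematics): for a morphism `g : X' ⟶ X` of `ℂ`-schemes the pull-back
`g^* : Hⁱ(X(ℂ); ℂ) → Hⁱ(X'(ℂ); ℂ)` carries the classes supported on a subset `Z ⊆ X` (the kernel of the
restriction to `(X ∖ Z)(ℂ)`, the tree's `classesSupportedOn`) to classes supported on `g⁻¹ Z ⊆ X'`
(`mem_classesSupportedOn_map_of_le_preimage`: restriction to the complements commutes with pull-back —
Grothendieck 1969 §1, functoriality of the filtration by supports; the `classesSupportedOn` analogue of
the tree's `mem_supportedClasses_map_of_iso`, with no hypothesis on `g`). For an isomorphism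
`e : X₀ ≅ X₁` and `i : Z ⟶ X₀`, `e⁻¹⁻¹(i(Z)) = (i ≫ e)(Z)`, whence the registered stub
`stub_supportAlongChart` VERBATIM: if `e^* x₁` is supported on `i(Z)` then `x₁ = (e⁻¹)^*(e^* x₁)` is
supported on `(i ≫ e)(Z)`.

## References

* [GrothendieckTopology1969] A. Grothendieck, Hodge's general conjecture is false for trivial reasons,
  Topology 8 (1969), §1.
-/

noncomputable section

-- `Summit.HodgeConjecture.HodgeConjecture.…` is the mandated namespace (single-conjunct summit).
set_option linter.dupNamespace false

namespace Summit.HodgeConjecture.HodgeConjecture.Theorems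

open CategoryTheory AlgebraicGeometry
open Literature.AlgebraicGeometry.Motives Literature.AlgebraicGeometry.HodgeTheory
  Literature.AlgebraicTopology.SingularHomology

/-- **Pull-back respects supports.** For a `ℂ`-morphism `g : X' ⟶ X`, a subset `Z ⊆ X` and a subset
`Z' ⊆ X'` containing `g⁻¹ Z`, a class `x ∈ Hⁱ(X(ℂ); ℂ)` supported on `Z` pulls back to a class
`g^* x` supported on `Z'`: `g(ℂ)` maps `(X' ∖ Z')(ℂ)` into `(X ∖ Z)(ℂ)`, and restriction commutes with
pull-back. [cite: GrothendieckTopology1969, §1] -/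
theorem mem_classesSupportedOn_map_of_le_preimage {X X' : SchemeOver ℂ} (g : X' ⟶ X)
    {Z : Set X.left} {Z' : Set X'.left} (hZ : g.left.base ⁻¹' Z ⊆ Z') {k : ℕ} {x : complexBetti X k}
    (hx : x ∈ classesSupportedOn X Z k) :
    complexBetti.map g k x ∈ classesSupportedOn X' Z' k := by
  rw [mem_classesSupportedOn_iff] at hx ⊢
  -- the continuous map `(X' ∖ Z')(ℂ) → (X ∖ Z)(ℂ)` induced by `g(ℂ)`
  let g' : C(complexPointsCompl X' Z', complexPointsCompl X Z) :=
    ⟨fun P ↦ ⟨AlgPoints.mapContinuous (L := ℂ) g P.1, fun hP ↦ P.2 (hZ hP)⟩, by fun_prop⟩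
  have hcomm : complexBetti.map g k ≫ complexBetti.restrictCompl X' Z' k =
      complexBetti.restrictCompl X Z k ≫ singularCohomology.map ℂ ℂ g' k := by
    rw [complexBetti.restrictCompl, complexBetti.restrictCompl, complexBetti.map,
      ← singularCohomology.map_comp, ← singularCohomology.map_comp]
    rfl
  change (complexBetti.map g k ≫ complexBetti.restrictCompl X' Z' k) x = 0
  rw [hcomm, CategoryTheory.comp_apply]
  change singularCohomology.map ℂ ℂ g' k (complexBetti.restrictCompl X Z k x) = 0
  rw [hx, map_zero]

/-- **Pull-back respects supports** (exact preimage): `x` supported on `Z ⊆ X` pulls back along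
`g : X' ⟶ X` to a class supported on `g⁻¹ Z`. [cite: GrothendieckTopology1969, §1] -/
theorem mem_classesSupportedOn_map_preimage {X X' : SchemeOver ℂ} (g : X' ⟶ X)
    {Z : Set X.left} {k : ℕ} {x : complexBetti X k} (hx : x ∈ classesSupportedOn X Z k) :
    complexBetti.map g k x ∈ classesSupportedOn X' (g.left.base ⁻¹' Z) k :=
  mem_classesSupportedOn_map_of_le_preimage g subset_rfl hx

/-- For an isomorphism `e : X₀ ≅ X₁` of `ℂ`-schemes and `i : Z ⟶ X₀`, the preimage under `e⁻¹` of
the image `i(Z)` is the image of `i ≫ e`. [folklore] -/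
theorem preimage_inv_range_eq_range_comp {X₀ X₁ : SchemeOver ℂ} (e : X₀ ≅ X₁) {Z : Scheme.{0}}
    (i : Z ⟶ X₀.left) :
    e.inv.left.base ⁻¹' Set.range i.base = Set.range (i ≫ e.hom.left).base := by
  ext y
  constructor
  · rintro ⟨z, hz⟩
    refine ⟨z, ?_⟩
    change e.hom.left.base (i.base z) = y
    rw [hz]
    change ((e.inv ≫ e.hom).left).base y = y
    rw [e.inv_hom_id]
    rfl
  · rintro ⟨z, rfl⟩
    refine ⟨z, ?_⟩
    change i.base z = ((e.hom ≫ e.inv).left).base (i.base z)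
    rw [e.hom_inv_id]
    rfl

/-- **Registered stub `stub_supportAlongChart`** of the line `bloch-lifts-fulton` (crux
`BlochSpreadEightFour`, stmt-HodgeConjecture-18884), VERBATIM: classes supported on `i(Z) ⊂ X₀` are
carried by the chart `e : X₀ ≅ X₁` to classes supported on `(i ≫ e)(Z) ⊂ X₁` — if `e^* x₁` is
supported on `i(Z)` then `x₁ = (e⁻¹)^* (e^* x₁)` is supported on `e⁻¹⁻¹(i(Z)) = (i ≫ e)(Z)`.
[cite: GrothendieckTopology1969, §1] -/
theorem stub_supportAlongChart :
    ∀ {X₀ X₁ : SchemeOver ℂ} (e : X₀ ≅ X₁) {Z : Scheme.{0}} (i : Z ⟶ X₀.left) (k : ℕ)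
      (x₁ : complexBetti X₁ k),
      complexBetti.map e.hom k x₁ ∈ classesSupportedOn X₀ (Set.range i.base) k →
        x₁ ∈ classesSupportedOn X₁ (Set.range (i ≫ e.hom.left).base) k := by
  intro X₀ X₁ e Z i k x₁ hx
  have h := mem_classesSupportedOn_map_preimage e.inv hx
  rwa [e.complexBetti_map_inv_map_hom, preimage_inv_range_eq_range_comp e i] at h

end Summit.HodgeConjecture.HodgeConjecture.Theorems

end
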